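import Summits.ValiantsHypothesis.ValiantsHypothesis.Theses.LacunarySymmetroid

/-!
# Line `extremal-inverse` — `DoorA26` read in ROOT SPACE: Chebyshev extremality + Gram inertia

HONEST FRAMING.  `DoorA26` (`= PosRootLawAt 2 6 19`, `ζ_sym(2,6) ≤ 19`; item stmt-ValiantsHypothesis-19979 of route
`LacunarySymmetroid`) is OPEN, typed, never asserted; registers of record `ζ_sym(2,6) ∈ {18, 19, 20}`.  This file is a
D-0145 LINE (ideator val-idea-4 g2, lens «o-minimal / fewnomial transfer»): four `sorry`s, exactly the stubs
`stub_gramForm`, `stub_extremalInverse`, `stub_onePositive`, `stub_signatureLaw6`, and ONE kernel-checked composition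
`DoorA26_of : … → DoorA26` concluding the crux BY NAME (plus the layer invariant `DoorA26_skeleton`).  Nothing here bears on `MatrixDescartes`
(stmt-ValiantsHypothesis-18050), Conjecture B (`KPlusLogSqLaw`) or `VP ≠ VNP`: the summit is NOT moved by this line.

STRATEGY (why).  A `(2,6)` symmetric pencil determinant is the quadratic-form fewnomial
`f = Σ_{i,j} M_{ij} X^{dᵢ+dⱼ}` of its GRAM MATRIX `M = ½(a cᵀ + c aᵀ) − b bᵀ = v vᵀ − u uᵀ − w wᵀ`
(`a_l, b_l, c_l` the entries of `S_l`; `stub_gramForm`), i.e. of a symmetric `6 × 6` matrix of rank `≤ 3` with at most ONE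
positive and at most TWO negative eigenvalues (`IsSymmetroidGram`) — and conversely every such `M` is a pencil.  Twenty positive
roots make `f` DESCARTES-SHARP on its 21 monomials, and a Descartes-sharp fewnomial is an EXTREMAL element of the
Chebyshev (ECT) system `{x^{E_0}, …, x^{E_20}}`: by Cramer its coefficient vector is, up to a scalar, the vector of SIGNED
MAXIMAL MINORS of the `20 × 21` generalized Vandermonde matrix at its roots (`stub_extremalInverse`; the minors are
positive by total positivity = Descartes again).  Hence `DoorA26` is EQUIVALENT to «no WOULD-BE GRAM `extremalGram E σ r c`
(`0 < r₀ < ⋯ < r₁₉`, Sidon support, `c ≠ 0`) is a symmetroid Gram» (`noExtremalSymmetroid_of`) — the pencil is ELIMINATED and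
the unknowns are the ROOTS (the cell's letter-space / would-be-Gram dictionary, theory g3 C13 at `(2,4)`, here TYPED at `(2,6)`
as kernel stubs).  The line's BET is strictly STRONGER than `DoorA26` and NOT a restatement of it: the **signature law at
`K = 6`** (`stub_signatureLaw6`) — every would-be Gram has at least TWO positive and at least TWO negative eigenvalues (typed
witness-style, `TwoPositive`: two `M`-orthogonal vectors of positive `M`-norm, demanded for `c` of either sign), which
contradicts `n₊ ≤ 1` (`stub_onePositive`, Loewner-order linear algebra).
EVIDENCE (this seat's instrument, local, seconds; pure-Python 60-digit Decimal): inertia of the equilibrated would-be Gram over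
random `(r, δ)` with REAL exponents (the in-tree rpow transfer `Census.RealExp.theses_doorA26_iff_rpow` makes `δ ∈ ℝ⁶`
legitimate): `K = 4`: (2,2) 285, (1,3) 62, (3,1) 53 of 400 — `n₊ = 1` is common and the symmetroid locus is met by IVT between
the (2,2) and (1,3) regions (= the cell's C13 certificate, `ζ(2,4) = 9`); `K = 5`: (2,3) 179, (3,2) 116, (1,4) 3, (4,1) 2 of
300, and a Nelder–Mead drive to `n₊ = 1` reaches inertia (4,1)/(1,4) in 30–90 s (room for `ζ(2,5) = 14`); `K = 6`: (3,3) 2401,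
(2,4) 356, (4,2) 243 and (1,5)/(5,1) in **0** of 3000, while three Nelder–Mead drives toward `n₊ = 1` stall at middle-block
inertia (2,2) (objective ≥ −0.011, versus −50 = success reached at `K = 5`); `K = 7`: (3,4) 264, (4,3) 229, (5,2) 3 of 496,
`min(n₊,n₋) ≥ 2` throughout.  Pattern `min(n₊, n₋) ≥ ⌊(K−2)/2⌋` for `K = 4…7`: a SIGNATURE LAW for the signed-minor Gram
matrices of one totally positive generalized Vandermonde; at `K = 6` it is exactly what forbids a symmetroid, at `K = 4, 5`
it permits one (and the formats are Descartes-sharp).  Every sample also shows a dominant HYPERBOLIC PAIR `±1/√2` with all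
other eigenvalues `≤ 1e−4` (sharp fewnomials of this format are near-products `(U−V)(U+V)`).
What the root-space form exposes: `n₊ ≥ 2` is an OPEN condition on a connected 24-dimensional parameter space, one statement
uniform over all 2 608 chambers, and the tools are determinantal inequalities among minors of ONE totally positive matrix
(Gantmacher–Krein sign-regularity of compound kernels, Karlin; Schur log-concavity, Lam–Postnikov–Pylyavskyy) — not sign /
Newton-cone (C25) / window rows in coefficient space, which the kernel pseudo-twenties p549496, p551561, p551757 show to be
blind.  SAME-WALL: the would-be-Gram form is an exact normal form (zero slack, priced as such); the signature law is where
slack is spent (it forbids MORE than symmetroids), deliberately, because an open inequality is provable chamber-uniformly.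
NOVELTY vs the registered line `census` (chamber table + W4 band law + LP certificates): different unknowns (roots, not
coefficients), an inertia INEQUALITY instead of necessary root-count rows; vs `Lift` (one-indefinite normal form),
`sign-split`, `lorentzian-shadow`, `span-rank`, `rolle-schur` (all pencil-space): none reads the coefficients off the roots;
vs the cell's C13 / engine-6 Gram scans (existence side at `(2,4)`, `(2,5)`): same dictionary, opposite face — inertia
RIGIDITY at `K = 6` as the obstruction, stated as a provable-or-killable law.  INSTRUMENT: `inv/search.py` (unknowns
`r ∈ ℝ²⁰_>`, `δ ∈ ℝ⁶` mod affine; objectives `rank3` = `log₁₀(σ₄/σ₃)` + sign flag, `npos` = drive to `n₊ = 1`),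
`inv/sample_inertia.py`, `inv/calib24.py` (calibration on `W₂₄`: coefficients of `F₂₄` = `−1/256 ×` the signed minors at its
nine roots, all ten; Gram eigenvalues `(+0.7071, ≈0, −1.65e−5, −0.7071)`).
CHEAPEST FALSIFIER: ONE `(r, δ)` at `K = 6` whose would-be Gram has `min(n₊, n₋) ≤ 1` (an OPEN target — random sampling or
`python3 inv/search.py 6 <seed> <sec> out.jsonl 80 30 npos`; kit-scale: 200 seeds × 600 s) kills `stub_signatureLaw6`
outright (`DoorA26` itself survives unless the point is also rank 3).  BEARS ON: stmt-ValiantsHypothesis-19979 (`DoorA26`),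
hence `¬ DescartesExtremalThin` (the cell's conjecture (T) at its first open register) and the `(2,K)` column ((T) versus
`LinearLetterLaw`); NOT on `MatrixDescartes` / B, NOT on VP ≠ VNP.
-/

set_option linter.dupNamespace false
set_option autoImplicit false

namespace Summit.ValiantsHypothesis.ValiantsHypothesis.Cruxes.DoorA26.ExtremalInverse

open Polynomial Matrix Finset
open scoped BigOperators
open Summit.ValiantsHypothesis.ValiantsHypothesis.Theses.LacunarySymmetroid (DoorA26)

/-- Gram matrix of a 6-term symmetric `2 × 2` pencil: `det(Σ_l X^{d_l} S_l) = Σ_{i,j} gram S i j · X^{dᵢ+dⱼ}`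
(`= ½(a cᵀ + c aᵀ) − b bᵀ` with `a_l = S_l 0 0`, `c_l = S_l 1 1`, `b_l = S_l 0 1`). -/
noncomputable def gram (S : Fin 6 → Matrix (Fin 2) (Fin 2) ℝ) : Matrix (Fin 6) (Fin 6) ℝ :=
  Matrix.of fun i j => (S i 0 0 * S j 1 1 + S j 0 0 * S i 1 1) / 2 - S i 0 1 * S j 0 1

/-- The symmetroid inertia: `M = v vᵀ − u uᵀ − w wᵀ` (rank `≤ 3`, `n₊ ≤ 1`, `n₋ ≤ 2`). Exactly the Gram matrices of
symmetric `2 × 2` pencils (`v = (a+c)/2`, `u = (a−c)/2`, `w = b`). -/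
def IsSymmetroidGram (M : Matrix (Fin 6) (Fin 6) ℝ) : Prop :=
  ∃ v u w : Fin 6 → ℝ, M = Matrix.vecMulVec v v - Matrix.vecMulVec u u - Matrix.vecMulVec w w

/-- `n₊(M) ≥ 2`, witness-style: two `M`-orthogonal vectors of positive `M`-norm (they span a plane on which the form is
positive definite; conversely two eigenvectors of positive eigenvalues qualify). -/
def TwoPositive (M : Matrix (Fin 6) (Fin 6) ℝ) : Prop :=
  ∃ x y : Fin 6 → ℝ, 0 < x ⬝ᵥ (M.mulVec x) ∧ 0 < y ⬝ᵥ (M.mulVec y) ∧ x ⬝ᵥ (M.mulVec y) = 0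

/-- The quadratic-form fewnomial `Σ_{i,j} M_{ij} X^{dᵢ+dⱼ}` of a coefficient matrix on the support `d`. -/
noncomputable def gramPoly (d : Fin 6 → ℕ) (M : Matrix (Fin 6) (Fin 6) ℝ) : ℝ[X] :=
  ∑ i, ∑ j, Polynomial.C (M i j) * X ^ (d i + d j)

/-- Maximal minor of the `20 × 21` generalized Vandermonde `(r_a ^ E_b)` with column `k` deleted. -/
noncomputable def vdmMinor (r : Fin 20 → ℝ) (E : Fin 21 → ℕ) (k : Fin 21) : ℝ :=
  (Matrix.of fun (a : Fin 20) (b : Fin 20) => r a ^ E (k.succAbove b)).det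

/-- The EXTREMAL GRAM MATRIX read off twenty roots: entry `(i,j)` is the signed minor at the position `σ i j` of
`dᵢ + dⱼ` in the sorted pair-sum list `E`, halved off the diagonal (the monomial `X^{dᵢ+dⱼ}`, `i ≠ j`, is hit twice). -/
noncomputable def extremalGram (E : Fin 21 → ℕ) (σ : Fin 6 → Fin 6 → Fin 21) (r : Fin 20 → ℝ) (c : ℝ) :
    Matrix (Fin 6) (Fin 6) ℝ :=
  Matrix.of fun i j => c * (-1 : ℝ) ^ ((σ i j : Fin 21) : ℕ) * vdmMinor r E (σ i j) / (if i = j then 1 else 2)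

/-! ## Registered stubs -/

/-- **stub (support, size S): the Gram form.**  The determinant of a symmetric `2 × 2` pencil is the quadratic-form
fewnomial of its Gram matrix, and that matrix has the symmetroid inertia.  Routine polynomial algebra
(`det_fin_two`, distributing the double sum) plus `v = (a+c)/2, u = (a−c)/2, w = b`. [folklore] -/
theorem stub_gramForm :
    ∀ (d : Fin 6 → ℕ) (S : Fin 6 → Matrix (Fin 2) (Fin 2) ℝ), (∀ l, (S l).IsSymm) →
      (∑ l, (X : ℝ[X]) ^ d l • (S l).map Polynomial.C).det = gramPoly d (gram S) ∧ IsSymmetroidGram (gram S) := by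
  sorry

/-- **stub (support, size M): extremal inverse = Chebyshev/Cramer.**  If the quadratic-form fewnomial of a symmetric
`M` on the support `d` has twenty distinct positive roots then (Descartes, `≤ 21` monomials) the 21 pair sums are pairwise
distinct, so they sort as a strictly increasing `E` with position map `σ`; the coefficient vector
`(M_{ii}; 2M_{ij})` lies in the kernel of the `20 × 21` generalized Vandermonde at the sorted roots `r`, whose maximal
minors are non-zero (total positivity = Descartes for 20-nomials), hence it is `c ×` the signed-minor vector:
`M = extremalGram E σ r c`.  Sources: Karlin–Studden, Tchebycheff systems (1966) Ch. I; Gantmacher–Krein (total positivity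
of generalized Vandermonde); tree `card_roots_toFinset_filter_pos_lt_card_support` (sparse Descartes). -/
theorem stub_extremalInverse :
    ∀ (d : Fin 6 → ℕ) (M : Matrix (Fin 6) (Fin 6) ℝ), M.IsSymm →
      19 < ((gramPoly d M).roots.toFinset.filter (fun t => 0 < t)).card →
      ∃ (E : Fin 21 → ℕ) (σ : Fin 6 → Fin 6 → Fin 21) (r : Fin 20 → ℝ) (c : ℝ),
        StrictMono E ∧ (∀ i j, σ i j = σ j i) ∧ (∀ i j, E (σ i j) = d i + d j) ∧ (∀ k, ∃ i j, σ i j = k) ∧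
        StrictMono r ∧ 0 < r 0 ∧ c ≠ 0 ∧ M = extremalGram E σ r c := by
  sorry

/-- **stub (support, size S): a symmetroid Gram has at most one positive eigenvalue.**  `M = v vᵀ − u uᵀ − w wᵀ ≤ v vᵀ`
in the Loewner order, so on a plane where the form `M` is positive definite the rank-one form `v vᵀ` would be positive
definite — impossible (take `z ≠ 0` in the plane with `v ⬝ᵥ z = 0`).  Elementary linear algebra over `Fin 6 → ℝ`. [folklore] -/
theorem stub_onePositive :
    ∀ M : Matrix (Fin 6) (Fin 6) ℝ, IsSymmetroidGram M → ¬ TwoPositive M := by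
  sorry

/-- **stub (THE BET, size XL; load-bearing): the SIGNATURE LAW at `K = 6`.**  For every Sidon support (sorted pair sums `E`,
symmetric surjective position map `σ` with `E (σ i j) = dᵢ + dⱼ`), every `0 < r₀ < ⋯ < r₁₉` and every `c ≠ 0`, the would-be
Gram `extremalGram E σ r c` admits two `M`-orthogonal vectors of positive `M`-norm — i.e. (both signs of `c`) every `K = 6`
would-be Gram has `n₊ ≥ 2` AND `n₋ ≥ 2`.  STRICTLY STRONGER than `DoorA26` (which forbids only the rank-3, inertia-(1,2)
would-be Grams) and not implied by it.  Evidence: `min(n₊,n₋) ≤ 1` in 0 of 3 000 random would-be Grams at `K = 6` (5 of 300 at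
`K = 5`, 115 of 400 at `K = 4`); three optimisation drives toward `n₊ = 1` stall (module docstring).  Why it might fail: a rare
corner of the 24-dimensional `(r, δ)`-space (clustered roots against a near-collision support) with inertia `(1,5)` — an OPEN
target, so a kit-scale run of `inv/search.py … npos` settles the cheap direction within hours.  Named attack: sign-regularity
of the compound matrices of a totally positive kernel (Gantmacher–Krein 1950; Karlin, *Total Positivity* 1968, Ch. 5) applied
to the `6 × 6` compression `(i,j) ↦ (−1)^{σ i j} Δ_{σ i j}` of the cofactor vector, and interlacing of the middle eigenvalue
block against the dominant hyperbolic pair seen in every sample.  Sources: Karlin–Studden 1966 Ch. I–II; arXiv:math/0502446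
(Lam–Postnikov–Pylyavskyy, Schur positivity); desk pseudo-twenties p549496 / p551561 / p551757 (what any row must beat). -/
theorem stub_signatureLaw6 :
    ∀ (d : Fin 6 → ℕ) (E : Fin 21 → ℕ) (σ : Fin 6 → Fin 6 → Fin 21) (r : Fin 20 → ℝ) (c : ℝ),
      StrictMono E → (∀ i j, σ i j = σ j i) → (∀ i j, E (σ i j) = d i + d j) → (∀ k, ∃ i j, σ i j = k) →
      StrictMono r → 0 < r 0 → c ≠ 0 → TwoPositive (extremalGram E σ r c) := by
  sorry

/-! ## Composition (kernel-checked, no `sorry`) -/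

theorem gram_isSymm (S : Fin 6 → Matrix (Fin 2) (Fin 2) ℝ) : (gram S).IsSymm := by
  unfold Matrix.IsSymm
  ext i j
  simp only [gram, Matrix.transpose_apply, Matrix.of_apply]
  ring

/-- **`DoorA26` from the four stubs.**  Gram form ∘ extremal inverse ∘ (one-positive ∘ signature law). -/
theorem DoorA26_of
    (hA : ∀ (d : Fin 6 → ℕ) (S : Fin 6 → Matrix (Fin 2) (Fin 2) ℝ), (∀ l, (S l).IsSymm) →
      (∑ l, (X : ℝ[X]) ^ d l • (S l).map Polynomial.C).det = gramPoly d (gram S) ∧ IsSymmetroidGram (gram S))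
    (hB : ∀ (d : Fin 6 → ℕ) (M : Matrix (Fin 6) (Fin 6) ℝ), M.IsSymm →
      19 < ((gramPoly d M).roots.toFinset.filter (fun t => 0 < t)).card →
      ∃ (E : Fin 21 → ℕ) (σ : Fin 6 → Fin 6 → Fin 21) (r : Fin 20 → ℝ) (c : ℝ),
        StrictMono E ∧ (∀ i j, σ i j = σ j i) ∧ (∀ i j, E (σ i j) = d i + d j) ∧ (∀ k, ∃ i j, σ i j = k) ∧
        StrictMono r ∧ 0 < r 0 ∧ c ≠ 0 ∧ M = extremalGram E σ r c)
    (hC₁ : ∀ M : Matrix (Fin 6) (Fin 6) ℝ, IsSymmetroidGram M → ¬ TwoPositive M)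
    (hC₂ : ∀ (d : Fin 6 → ℕ) (E : Fin 21 → ℕ) (σ : Fin 6 → Fin 6 → Fin 21) (r : Fin 20 → ℝ) (c : ℝ),
      StrictMono E → (∀ i j, σ i j = σ j i) → (∀ i j, E (σ i j) = d i + d j) → (∀ k, ∃ i j, σ i j = k) →
      StrictMono r → 0 < r 0 → c ≠ 0 → TwoPositive (extremalGram E σ r c)) :
    DoorA26 := by
  intro d S hS
  by_contra h
  push Not at h
  obtain ⟨hdet, hgram⟩ := hA d S hS
  rw [hdet] at h
  obtain ⟨E, σ, r, c, hE, hσ, hσE, hsurj, hr, hr0, hc, hM⟩ := hB d (gram S) (gram_isSymm S) h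
  exact hC₁ _ (hM ▸ hgram) (hC₂ d E σ r c hE hσ hσE hsurj hr hr0 hc)

/-- Informational (for the critics): the two linear-algebra facts turn the signature law into the would-be-Gram form of the
door — no `K = 6` would-be Gram is a symmetroid Gram — the statement `DoorA26` is equivalent to modulo `stub_gramForm`,
`stub_extremalInverse` and their (true) converses. -/
theorem noExtremalSymmetroid_of
    (hC₁ : ∀ M : Matrix (Fin 6) (Fin 6) ℝ, IsSymmetroidGram M → ¬ TwoPositive M)
    (hC₂ : ∀ (d : Fin 6 → ℕ) (E : Fin 21 → ℕ) (σ : Fin 6 → Fin 6 → Fin 21) (r : Fin 20 → ℝ) (c : ℝ),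
      StrictMono E → (∀ i j, σ i j = σ j i) → (∀ i j, E (σ i j) = d i + d j) → (∀ k, ∃ i j, σ i j = k) →
      StrictMono r → 0 < r 0 → c ≠ 0 → TwoPositive (extremalGram E σ r c)) :
    ∀ (d : Fin 6 → ℕ) (E : Fin 21 → ℕ) (σ : Fin 6 → Fin 6 → Fin 21) (r : Fin 20 → ℝ) (c : ℝ),
      StrictMono E → (∀ i j, σ i j = σ j i) → (∀ i j, E (σ i j) = d i + d j) → (∀ k, ∃ i j, σ i j = k) →
      StrictMono r → 0 < r 0 → c ≠ 0 → ¬ IsSymmetroidGram (extremalGram E σ r c) :=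
  fun d E σ r c hE hσ hσE hsurj hr hr0 hc hS => hC₁ _ hS (hC₂ d E σ r c hE hσ hσE hsurj hr hr0 hc)

/-- The line's layer invariant: `DoorA26` rests on exactly the four registered `sorry`s. -/
theorem DoorA26_skeleton : DoorA26 :=
  DoorA26_of stub_gramForm stub_extremalInverse stub_onePositive stub_signatureLaw6

end Summit.ValiantsHypothesis.ValiantsHypothesis.Cruxes.DoorA26.ExtremalInverse
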